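import Summits.AnomalousDissipation.AnomalousDissipation.Theorems.SteadyCoherentFractionRootsPlanarWitnessRoot
import Literature.Analysis.FunctionSpaces.TorusTrigPoly
import Literature.Analysis.FunctionSpaces.TorusVectorParseval
import Literature.Analysis.FunctionSpaces.TorusHolderSobolevEmbedding
import Literature.Analysis.FluidPDE.TurbWave0

/-!
# The crossed-shear root of Euler + drift + Kolmogorov force on `T³` — III: the planar-symmetry defect is positive

`v₁` is the trigonometric polynomial `½(e_(2,0,0)+e_(-2,0,0)) + ⅛Σ e_(±2,0,±1) + (c_K/4)(e_(0,0,1)+e_(0,0,-1))`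
(`V1_eq_trigPoly`), so `𝓕v₁(2,0,0) = ½`, `𝓕v₁(0,0,1) = c_K/4`. For a horizontal lattice direction `p = (a, b) ≠ 0` and the
shift `h_s = (s a, 0, s b)`: Parseval (one mode of the second component) and the translation rule
`𝓕(f(·+h) - f)(k) = (e_k(h) - 1) f̂(k)` give `∫‖v(x+h_s) - v(x)‖² ≥ (2 - 2cos 2πns)‖𝓕v₁(k)‖²` with `(k, n) = ((0,0,1), b)` if
`b ≠ 0`, else `((2,0,0), 2a)`; integrating in `s ∈ (0,1)`: `½∫₀¹∫‖v(x+h_s) - v(x)‖² ≥ c_K²/16 > 0` (`defect_vfield_ge`).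
-/

noncomputable section

-- `Summit.<Summit>.<Problem>` is the tree's mandated summit-side namespace (CONVENTIONS §2); for this
-- single-conjunct summit the two segments coincide, so the duplicate is deliberate.
set_option linter.dupNamespace false

namespace Summit.AnomalousDissipation.AnomalousDissipation.Theorems.CrossedShearRoot

open Real MeasureTheory
open scoped InnerProductSpace
open Literature.Analysis.FunctionSpaces Literature.Analysis.FunctionSpaces.Torus Literature.Analysis.FluidPDE

/-! ## §8 The second component as a trigonometric polynomial; two Fourier coefficients

No auxiliary definitions (pure proof file downstream): the unit characters `Eᵢ(x) = exp(2πi·repr x i)` are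
written out. -/

/-- Characters in coordinates: `e_k(x) = ∏ᵢ exp(2πi·repr x i) ^ kᵢ`. [folklore] -/
theorem mFourier_eq_prod_exp (k : Fin 3 → ℤ) (x : (UnitAddTorus (Fin 3))) :
    UnitAddTorus.mFourier k x = ∏ i, Complex.exp (2 * π * Complex.I * (repr x i : ℂ)) ^ (k i) := by
  conv_lhs => rw [← proj_repr x]
  simp only [UnitAddTorus.mFourier, ContinuousMap.coe_mk, proj, fourier_coe_apply, Complex.ofReal_one, div_one]
  refine Finset.prod_congr rfl fun i _ => ?_
  rw [← Complex.exp_int_mul]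
  congr 1
  ring

/-- `cos(4π repr x i) = (Eᵢ² + Eᵢ⁻²)/2` in `ℂ`, `Eᵢ = exp(2πi·repr x i)`. [folklore] -/
theorem c4_repr_eq (i : Fin 3) (x : (UnitAddTorus (Fin 3))) :
    (c4 (repr x i) : ℂ) = (Complex.exp (2 * π * Complex.I * (repr x i : ℂ)) ^ 2 +
      (Complex.exp (2 * π * Complex.I * (repr x i : ℂ)) ^ 2)⁻¹) / 2 := by
  have h := Complex.two_cos ((4 * π * repr x i : ℝ) : ℂ)
  have e1 : Complex.exp (((4 * π * repr x i : ℝ) : ℂ) * Complex.I) =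
      Complex.exp (2 * π * Complex.I * (repr x i : ℂ)) ^ 2 := by
    rw [← Complex.exp_nat_mul]; congr 1; push_cast; ring
  have e2 : Complex.exp (-((4 * π * repr x i : ℝ) : ℂ) * Complex.I) =
      (Complex.exp (2 * π * Complex.I * (repr x i : ℂ)) ^ 2)⁻¹ := by
    rw [← e1, ← Complex.exp_neg]; congr 1; ring
  rw [e1, e2] at h
  unfold c4
  rw [Complex.ofReal_cos]
  linear_combination h / 2

/-- `ρ(repr x i) = 1 + (Eᵢ + Eᵢ⁻¹)/4` in `ℂ`. [folklore] -/
theorem rho_repr_eq (i : Fin 3) (x : (UnitAddTorus (Fin 3))) :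
    (rho (repr x i) : ℂ) = 1 + (Complex.exp (2 * π * Complex.I * (repr x i : ℂ)) +
      (Complex.exp (2 * π * Complex.I * (repr x i : ℂ)))⁻¹) / 4 := by
  have h := Complex.two_cos ((2 * π * repr x i : ℝ) : ℂ)
  have e1 : Complex.exp (((2 * π * repr x i : ℝ) : ℂ) * Complex.I) =
      Complex.exp (2 * π * Complex.I * (repr x i : ℂ)) := by
    congr 1; push_cast; ring
  have e2 : Complex.exp (-((2 * π * repr x i : ℝ) : ℂ) * Complex.I) =
      (Complex.exp (2 * π * Complex.I * (repr x i : ℂ)))⁻¹ := by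
    rw [← e1, ← Complex.exp_neg]; congr 1; ring
  rw [e1, e2] at h
  unfold rho
  push_cast at h ⊢
  linear_combination h / 4

/-- `v₁` (complexified) is the trigonometric polynomial
`½(e_(2,0,0) + e_(-2,0,0)) + ⅛ Σ_{±,±} e_(±2,0,±1) + (c_K/4)(e_(0,0,1) + e_(0,0,-1))`. [folklore] -/
theorem V1_eq_trigPoly : (fun x : (UnitAddTorus (Fin 3)) => (V1 x : ℂ)) =
    Torus.trigPoly ({![2, 0, 0], ![-2, 0, 0], ![2, 0, 1], ![2, 0, -1], ![-2, 0, 1], ![-2, 0, -1], ![0, 0, 1],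
      ![0, 0, -1]} : Finset (Fin 3 → ℤ))
      (fun k => if k 2 = 0 then (1 / 2 : ℂ) else if k 0 = 0 then (cK : ℂ) / 4 else 1 / 8) := by
  funext x
  rw [Torus.trigPoly_apply]
  rw [Finset.sum_insert (by decide), Finset.sum_insert (by decide), Finset.sum_insert (by decide),
    Finset.sum_insert (by decide), Finset.sum_insert (by decide), Finset.sum_insert (by decide),
    Finset.sum_insert (by decide), Finset.sum_singleton]
  simp only [mFourier_eq_prod_exp, Fin.prod_univ_three, Matrix.cons_val_zero, Matrix.cons_val_one,
    Matrix.cons_val_two, Matrix.tail_cons, Matrix.head_cons, smul_eq_mul]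
  unfold V1
  push_cast
  rw [c4_repr_eq, rho_repr_eq]
  have h0 := Complex.exp_ne_zero (2 * π * Complex.I * (repr x 0 : ℂ))
  have h2 := Complex.exp_ne_zero (2 * π * Complex.I * (repr x 2 : ℂ))
  simp only [zpow_zero, zpow_one, zpow_two, zpow_neg, mul_one, one_mul]
  norm_num
  field_simp
  ring


/-- `𝓕v₁(2,0,0) = 1/2`. [folklore] -/
theorem mFourierCoeff_V1_two : UnitAddTorus.mFourierCoeff (fun x : (UnitAddTorus (Fin 3)) => (V1 x : ℂ)) ![2, 0, 0] = 1 / 2 := by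
  rw [V1_eq_trigPoly, Torus.mFourierCoeff_trigPoly]
  simp only [Finset.mem_insert, Finset.mem_singleton]
  norm_num [Matrix.cons_val_two, Matrix.tail_cons, Matrix.head_cons]

/-- `𝓕v₁(0,0,1) = c_K/4`. [folklore] -/
theorem mFourierCoeff_V1_one : UnitAddTorus.mFourierCoeff (fun x : (UnitAddTorus (Fin 3)) => (V1 x : ℂ)) ![0, 0, 1] = (cK : ℂ) / 4 := by
  rw [V1_eq_trigPoly, Torus.mFourierCoeff_trigPoly]
  have hmem : (![0, 0, 1] : Fin 3 → ℤ) ∈ ({![2, 0, 0], ![-2, 0, 0], ![2, 0, 1], ![2, 0, -1], ![-2, 0, 1], ![-2, 0, -1],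
      ![0, 0, 1], ![0, 0, -1]} : Finset (Fin 3 → ℤ)) := by decide
  rw [if_pos hmem]
  simp

/-! ## §9 The planar-symmetry defect of the field is bounded below

For `p = (a, b) ∈ ℤ² ∖ 0` and the horizontal shift `h_s = (s a, 0, s b)`:
`½∫₀¹ ∫ ‖v(x + h_s) - v(x)‖² dx ds ≥ c_K²/16 > 0` (one Fourier mode of `v₁`: `(0,0,1)` if `b ≠ 0`, else `(2,0,0)`). -/

/-- The horizontal shift by `s·(a, 0, b)` evaluated in the character `e_k`: `e_k(h_s) = exp(2πi s (k₀a + k₂b))`. [folklore] -/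
theorem mFourier_hshift (k : Fin 3 → ℤ) (a b : ℤ) (s : ℝ) :
    UnitAddTorus.mFourier k (Literature.Analysis.FluidPDE.toTorus (fun i => s * (![(a : ℝ), 0, (b : ℝ)] : Fin 3 → ℝ) i)) =
      Complex.exp (2 * π * Complex.I * (s * (k 0 * a + k 2 * b) : ℝ)) := by
  simp only [UnitAddTorus.mFourier, ContinuousMap.coe_mk, Literature.Analysis.FluidPDE.toTorus, fourier_coe_apply,
    Complex.ofReal_one, div_one]
  rw [Fin.prod_univ_three, ← Complex.exp_add, ← Complex.exp_add]
  congr 1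
  simp only [Matrix.cons_val_zero, Matrix.cons_val_one, Matrix.cons_val_two, Matrix.tail_cons, Matrix.head_cons]
  push_cast
  ring

/-- `‖e^{2πiθ} - 1‖² = 2 - 2cos(2πθ)`. [folklore] -/
theorem norm_exp_sub_one_sq (θ : ℝ) :
    ‖Complex.exp (2 * π * Complex.I * (θ : ℝ)) - 1‖ ^ 2 = 2 - 2 * Real.cos (2 * π * θ) := by
  have h := Complex.norm_exp_I_mul_ofReal_sub_one (2 * π * θ)
  rw [show Complex.I * ((2 * π * θ : ℝ) : ℂ) = 2 * π * Complex.I * (θ : ℝ) by push_cast; ring] at h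
  rw [h, Real.norm_eq_abs, sq_abs, mul_pow]
  have hs : Real.sin (2 * π * θ / 2) ^ 2 = 1 / 2 - Real.cos (2 * π * θ) / 2 := by
    rw [Real.sin_sq, Real.cos_sq (2 * π * θ / 2), show 2 * (2 * π * θ / 2) = 2 * π * θ by ring]
    ring
  rw [hs]
  ring

/-- The second component of the increment: `(v(x+h) - v(x))₁ = v₁(x+h) - v₁(x)`. [folklore] -/
theorem vfield_increment_apply_one (h x : (UnitAddTorus (Fin 3))) : (vfield (x + h) - vfield x) 1 = V1 (x + h) - V1 x := by
  simp [vfield]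

/-- `v₁` is continuous, hence (complexified) integrable. [folklore] -/
theorem integrable_V1_complex : Integrable (fun x : (UnitAddTorus (Fin 3)) => (V1 x : ℂ)) volume :=
  (Complex.continuous_ofReal.comp isSmooth_V1.continuous).integrable_unitAddTorus

/-- **One-mode lower bound.** `∫ ‖v(x + h) - v(x)‖² dx ≥ ‖e_k(h) - 1‖² ‖𝓕v₁(k)‖²` for every `h ∈ T³` and every
frequency `k` (Parseval, the `k`-th term, second component). [folklore] -/
theorem integral_increment_sq_ge (h : (UnitAddTorus (Fin 3))) (k : Fin 3 → ℤ) :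
    ‖UnitAddTorus.mFourier k h - 1‖ ^ 2 * ‖UnitAddTorus.mFourierCoeff (fun x : (UnitAddTorus (Fin 3)) => (V1 x : ℂ)) k‖ ^ 2 ≤
      ∫ x, ‖vfield (x + h) - vfield x‖ ^ 2 := by
  set w : (UnitAddTorus (Fin 3)) → (EuclideanSpace ℝ (Fin 3)) := fun x => vfield (x + h) - vfield x with hw_def
  have hw : IsSmooth w := (isSmooth_vfield.comp_add_right h).sub isSmooth_vfield
  have hsum := Torus.hasSum_sq_norm_mFourierCoeff_complexify (hw.memLp 2)
  have h1 : ‖UnitAddTorus.mFourierCoeff (EuclideanSpace.complexify ∘ w) k‖ ^ 2 ≤ ∫ x, ‖w x‖ ^ 2 :=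
    le_hasSum hsum k fun j _ => sq_nonneg _
  have hint : Integrable (EuclideanSpace.complexify ∘ w) volume :=
    (EuclideanSpace.complexify.continuous.comp hw.continuous).integrable_unitAddTorus
  have h2 : UnitAddTorus.mFourierCoeff (EuclideanSpace.complexify ∘ w) k 1 =
      UnitAddTorus.mFourierCoeff (fun x : (UnitAddTorus (Fin 3)) => ((V1 (x + h) : ℂ) - (V1 x : ℂ))) k := by
    rw [Torus.mFourierCoeff_apply_euclidean hint k 1]
    congr 1
    funext x
    simp only [Function.comp_apply, EuclideanSpace.complexify_apply, hw_def, vfield_increment_apply_one,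
      Complex.ofReal_sub]
  have h3 : UnitAddTorus.mFourierCoeff (fun x : (UnitAddTorus (Fin 3)) => ((V1 (x + h) : ℂ) - (V1 x : ℂ))) k =
      (UnitAddTorus.mFourier k h - 1) • UnitAddTorus.mFourierCoeff (fun x : (UnitAddTorus (Fin 3)) => (V1 x : ℂ)) k :=
    Torus.mFourierCoeff_comp_add_right_sub integrable_V1_complex h k
  have h4 : ‖UnitAddTorus.mFourierCoeff (EuclideanSpace.complexify ∘ w) k 1‖ ^ 2 ≤
      ‖UnitAddTorus.mFourierCoeff (EuclideanSpace.complexify ∘ w) k‖ ^ 2 := by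
    rw [EuclideanSpace.norm_sq_eq]
    exact Finset.single_le_sum (f := fun i => ‖UnitAddTorus.mFourierCoeff (EuclideanSpace.complexify ∘ w) k i‖ ^ 2)
      (fun i _ => sq_nonneg _) (Finset.mem_univ 1)
  rw [h2, h3, norm_smul, mul_pow] at h4
  exact h4.trans h1

/-- The shift `s ↦ h_s` is continuous. [folklore] -/
theorem continuous_hshift (a b : ℤ) :
    Continuous fun s : ℝ => Literature.Analysis.FluidPDE.toTorus (fun i => s * (![(a : ℝ), 0, (b : ℝ)] : Fin 3 → ℝ) i) := by
  refine continuous_pi fun i => ?_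
  exact (AddCircle.continuous_mk' (1 : ℝ)).comp (continuous_id.mul continuous_const)

/-- `s ↦ ∫ ‖v(x + h_s) - v(x)‖² dx` is continuous (dominated convergence: `v` is bounded). [folklore] -/
theorem continuous_integral_increment_sq (a b : ℤ) :
    Continuous fun s : ℝ => ∫ x, ‖vfield (x + Literature.Analysis.FluidPDE.toTorus
      (fun i => s * (![(a : ℝ), 0, (b : ℝ)] : Fin 3 → ℝ) i)) - vfield x‖ ^ 2 := by
  have hv : Continuous vfield := isSmooth_vfield.continuous
  obtain ⟨C, hC⟩ : ∃ C, ∀ x, ‖vfield x‖ ≤ C := by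
    obtain ⟨C, hC⟩ := isCompact_univ.exists_bound_of_continuousOn hv.continuousOn
    exact ⟨C, fun x => hC x (Set.mem_univ _)⟩
  have hsh := continuous_hshift a b
  refine continuous_of_dominated (bound := fun _ => (C + C) ^ 2) ?_ ?_ (integrable_const _) ?_
  · intro s
    exact (((hv.comp (continuous_id.add continuous_const)).sub hv).norm.pow 2).aestronglyMeasurable
  · intro s
    refine ae_of_all _ fun x => ?_
    rw [Real.norm_eq_abs, abs_pow, abs_norm]
    have h1 : ‖vfield (x + Literature.Analysis.FluidPDE.toTorus (fun i => s * (![(a : ℝ), 0, (b : ℝ)] : Fin 3 → ℝ) i)) -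
        vfield x‖ ≤ C + C := (norm_sub_le _ _).trans (add_le_add (hC _) (hC _))
    exact pow_le_pow_left₀ (norm_nonneg _) h1 2
  · refine ae_of_all _ fun x => ?_
    exact ((hv.comp (continuous_const.add hsh)).sub continuous_const).norm.pow 2

/-- `∫₀¹ (2 - 2cos(2πns)) ds = 2` for a non-zero integer `n`. [folklore] -/
theorem integral_two_sub_two_cos {n : ℤ} (hn : n ≠ 0) :
    ∫ s in (0 : ℝ)..1, (2 - 2 * Real.cos (2 * π * (s * n))) = 2 := by
  have hc : (2 * π * (n : ℝ)) ≠ 0 := mul_ne_zero (by positivity) (Int.cast_ne_zero.mpr hn)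
  have h1 : ∫ s in (0 : ℝ)..1, Real.cos (2 * π * (s * n)) = 0 := by
    have h := intervalIntegral.integral_comp_mul_right (a := 0) (b := 1) (fun x => Real.cos x) hc
    simp only [zero_mul, one_mul] at h
    rw [show (fun s : ℝ => Real.cos (2 * π * (s * n))) = fun s => Real.cos (s * (2 * π * n)) by funext s; ring_nf, h,
      integral_cos, Real.sin_zero, sub_zero, show 2 * π * (n : ℝ) = ((2 * n : ℤ) : ℝ) * π by push_cast; ring,
      Real.sin_int_mul_pi, smul_zero]
  have hi : IntervalIntegrable (fun s : ℝ => 2 * Real.cos (2 * π * (s * n))) MeasureTheory.volume 0 1 :=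
    (by fun_prop : Continuous fun s : ℝ => 2 * Real.cos (2 * π * (s * n))).intervalIntegrable _ _
  rw [intervalIntegral.integral_sub intervalIntegrable_const hi, intervalIntegral.integral_const_mul, h1,
    intervalIntegral.integral_const]
  simp

/-- `c_K²/16 ≤ 1/4`. [folklore] -/
theorem cK_sq_div_le : cK ^ 2 / 16 ≤ 1 / 4 := by
  have hπ : 1 ≤ π := by linarith [Real.pi_gt_three]
  have h1 : cK ^ 2 = 1 / (16 * π ^ 2) := by unfold cK; field_simp; ring
  rw [h1, div_div, div_le_div_iff₀ (by positivity) (by positivity)]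
  nlinarith

/-- **Defect lower bound for the field.** For every `(a, b) ≠ (0, 0)`:
`c_K²/16 ≤ ½∫₀¹ ∫ ‖v(x + s(a,0,b)) - v(x)‖² dx ds`. [folklore] -/
theorem defect_vfield_ge (a b : ℤ) (hab : (a, b) ≠ (0, 0)) :
    cK ^ 2 / 16 ≤ (1 / 2 : ℝ) * ∫ s in (0 : ℝ)..1, ∫ x, ‖vfield (x + Literature.Analysis.FluidPDE.toTorus
      (fun i => s * (![(a : ℝ), 0, (b : ℝ)] : Fin 3 → ℝ) i)) - vfield x‖ ^ 2 := by
  -- the mode and the winding number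
  obtain ⟨k, n, hn, hk, hcoef⟩ : ∃ (k : Fin 3 → ℤ) (n : ℤ), n ≠ 0 ∧ (k 0 * a + k 2 * b = n) ∧
      cK ^ 2 / 16 ≤ ‖UnitAddTorus.mFourierCoeff (fun x : (UnitAddTorus (Fin 3)) => (V1 x : ℂ)) k‖ ^ 2 := by
    by_cases hb : b = 0
    · subst hb
      have ha : a ≠ 0 := fun ha => hab (by rw [ha])
      refine ⟨![2, 0, 0], 2 * a, mul_ne_zero two_ne_zero ha, by simp, ?_⟩
      rw [mFourierCoeff_V1_two]
      norm_num
      linarith [cK_sq_div_le]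
    · refine ⟨![0, 0, 1], b, hb, by simp, ?_⟩
      rw [mFourierCoeff_V1_one, norm_div, Complex.norm_real, Real.norm_eq_abs, div_pow, sq_abs]
      norm_num
  -- pointwise in s
  have hpt : ∀ s : ℝ, (cK ^ 2 / 16) * (2 - 2 * Real.cos (2 * π * (s * n))) ≤
      ∫ x, ‖vfield (x + Literature.Analysis.FluidPDE.toTorus (fun i => s * (![(a : ℝ), 0, (b : ℝ)] : Fin 3 → ℝ) i)) -
        vfield x‖ ^ 2 := by
    intro s
    have h := integral_increment_sq_ge (Literature.Analysis.FluidPDE.toTorus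
      (fun i => s * (![(a : ℝ), 0, (b : ℝ)] : Fin 3 → ℝ) i)) k
    rw [mFourier_hshift, show (s * (k 0 * a + k 2 * b) : ℝ) = s * n by rw [← hk]; push_cast; ring,
      norm_exp_sub_one_sq] at h
    have h0 : 0 ≤ 2 - 2 * Real.cos (2 * π * (s * n)) := by linarith [Real.cos_le_one (2 * π * (s * n))]
    calc cK ^ 2 / 16 * (2 - 2 * Real.cos (2 * π * (s * ↑n)))
        ≤ ‖UnitAddTorus.mFourierCoeff (fun x : (UnitAddTorus (Fin 3)) => (V1 x : ℂ)) k‖ ^ 2 * (2 - 2 * Real.cos (2 * π * (s * ↑n))) :=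
          mul_le_mul_of_nonneg_right hcoef h0
      _ ≤ _ := by rw [mul_comm]; exact h
  have hi1 : IntervalIntegrable (fun s : ℝ => cK ^ 2 / 16 * (2 - 2 * Real.cos (2 * π * (s * n))))
      MeasureTheory.volume 0 1 :=
    (by fun_prop : Continuous fun s : ℝ => cK ^ 2 / 16 * (2 - 2 * Real.cos (2 * π * (s * n)))).intervalIntegrable _ _
  have hi2 := (continuous_integral_increment_sq a b).intervalIntegrable (μ := MeasureTheory.volume) 0 1
  have hmono := intervalIntegral.integral_mono_on zero_le_one hi1 hi2 fun s _ => hpt s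
  rw [intervalIntegral.integral_const_mul, integral_two_sub_two_cos hn] at hmono
  linarith

end Summit.AnomalousDissipation.AnomalousDissipation.Theorems.CrossedShearRoot

end
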